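import Mathlib
import Literature.AlgebraicGeometry.Resolution.WeightedResolutionDatum

/-!
# The cusp move `(x + y, y; 3, 2)`: a legal admissible weighted move whose filtration is NOT homogeneous

[OURS · L1 W4.3 · chain w43, seat tri-2 (TRIAGE v4 §D5 (a))] Negative/calibration helper for crux
`WeightedConstruction` (stmt-ResolutionOfSingularities-0571) and the door crux `HypersurfaceCentreConstruction`
(stmt-ResolutionOfSingularities-19897), sub-stub [S5] «(hom) of the glued centre» of the H2c″ assembly.
NOT a statement of any manuscript; no Hironaka statement is used as a premise.

At the cusp `f = x² − y³` (char `≠ 2, 3`) the pair `u = (x + y, y)`, `w = (3, 2)` is a regular system of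
parameters with positive weights and support the closed point `= Sing V(f)`, so it is a LEGAL move of the
bare-germ games (`LocalWeightedDrop`: `θ` free; `LocalWeightedDropEFT`: `u` free).  Its degree-`3` piece
`I₃ = weightedMonomialIdeal u w 3 = (x + y, y²)` contains `x + y` (`add_mem_pieceThree`) but NOT `x`
(`X_zero_not_mem_pieceThree`; certificate: the `k`-algebra map `k[x,y] → k[ε]/(ε²)`, `x ↦ ε`, `y ↦ −ε`
kills every generator `(x+y)^a · y^b`, `3a + 2b ≥ 3`, and sends `x` to `ε ≠ 0`).  Since `x` is the weight-`3`
component of `x + y` for the grading `wt x = 3, wt y = 2` (`weightedHomogeneousComponent_three_X_add_X`) — under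
which `(f)` is homogeneous and the constants sit in degree `0` — the filtration `(Iₙ)` is not homogeneous
(`pieceThree_not_closed_under_component`): the move violates clause `(hom)` of `IsAdmissibleCentre` /
`HypersurfaceTerminatingCentreDatum.centre_isHomogeneous`.  Reading: a bare-germ witness is not globalizable
move-by-move; [S5] genuinely consumes the smooth-compatibility and unit-invariance clauses (c11)/(c12) of
`LocalWeightedDropEFT3`.  Pure commutative algebra in `k[x, y] = MvPolynomial (Fin 2) k` (`X 0 = x`, `X 1 = y`)
over every commutative ring `k` (non-membership needs `k` nontrivial).  AI-written; weaker than expert review.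
-/

set_option linter.dupNamespace false

open MvPolynomial
open Literature.AlgebraicGeometry.Resolution

namespace Summit.ResolutionOfSingularities.ResolutionOfSingularities.Theorems.WeightedConstruction.Negative.CuspInhomogeneousMove

variable (k : Type) [CommRing k]

/-- `x + y ∈ I₃` (it is the generator `u₀`, of weight `3`). [folklore] -/
theorem add_mem_pieceThree :
    (X 0 + X 1 : MvPolynomial (Fin 2) k) ∈
      weightedMonomialIdeal (![X 0 + X 1, X 1] : Fin 2 → MvPolynomial (Fin 2) k) ![3, 2] 3 := by
  refine Ideal.subset_span ⟨![1, 0], ?_, ?_⟩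
  · simp [Fin.sum_univ_two]
  · simp [Fin.prod_univ_two]

/-- `(−ε)ⁿ = 0` in the dual numbers for `n ≥ 2`. [folklore] -/
theorem neg_eps_pow_eq_zero {n : ℕ} (hn : 2 ≤ n) : (-DualNumber.eps : DualNumber k) ^ n = 0 := by
  obtain ⟨m, rfl⟩ := Nat.exists_eq_add_of_le hn
  rw [pow_add, pow_two, neg_mul_neg, DualNumber.eps_mul_eps, zero_mul]

/-- Every generator `(x + y)^a · y^b` with `3a + 2b ≥ 3` dies at the dual-number point `x ↦ ε, y ↦ −ε`:
`I₃ ≤ ker`. [folklore] -/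
theorem pieceThree_le_ker :
    weightedMonomialIdeal (![X 0 + X 1, X 1] : Fin 2 → MvPolynomial (Fin 2) k) ![3, 2] 3 ≤
      RingHom.ker (MvPolynomial.aeval ![DualNumber.eps, -DualNumber.eps] :
        MvPolynomial (Fin 2) k →ₐ[k] DualNumber k).toRingHom := by
  rw [weightedMonomialIdeal, Ideal.span_le]
  rintro x ⟨α, hα, rfl⟩
  rw [SetLike.mem_coe, RingHom.mem_ker]
  have h0' : (MvPolynomial.aeval ![DualNumber.eps, -DualNumber.eps] : MvPolynomial (Fin 2) k →ₐ[k] DualNumber k)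
      ((![X 0 + X 1, X 1] : Fin 2 → MvPolynomial (Fin 2) k) 0) = 0 := by
    simp
  have h1' : (MvPolynomial.aeval ![DualNumber.eps, -DualNumber.eps] : MvPolynomial (Fin 2) k →ₐ[k] DualNumber k)
      ((![X 0 + X 1, X 1] : Fin 2 → MvPolynomial (Fin 2) k) 1) = -DualNumber.eps := by
    simp
  simp only [AlgHom.toRingHom_eq_coe, RingHom.coe_coe]
  rw [Fin.prod_univ_two, map_mul, map_pow, map_pow, h0', h1']
  rcases Nat.eq_zero_or_pos (α 0) with h0 | h0
  · have h1 : 2 ≤ α 1 := by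
      simp [Fin.sum_univ_two, h0] at hα
      omega
    rw [h0, pow_zero, one_mul, neg_eps_pow_eq_zero k h1]
  · rw [zero_pow (Nat.pos_iff_ne_zero.mp h0), zero_mul]

/-- **`x ∉ I₃ = (x + y, y²)`** — the weight-`3` component of the member `x + y` is not in the piece. [folklore] -/
theorem X_zero_not_mem_pieceThree [Nontrivial k] :
    (X 0 : MvPolynomial (Fin 2) k) ∉
      weightedMonomialIdeal (![X 0 + X 1, X 1] : Fin 2 → MvPolynomial (Fin 2) k) ![3, 2] 3 := by
  intro h
  have h' := pieceThree_le_ker k h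
  rw [RingHom.mem_ker] at h'
  have h'' : (DualNumber.eps : DualNumber k) = 0 := by
    simpa using h'
  have h3 := congrArg TrivSqZeroExt.snd h''
  simp only [DualNumber.snd_eps, TrivSqZeroExt.snd_zero] at h3
  exact one_ne_zero h3

/-- The weight-`3` component of `x + y` for the grading `wt x = 3`, `wt y = 2` is `x`. [folklore] -/
theorem weightedHomogeneousComponent_three_X_add_X :
    weightedHomogeneousComponent (![3, 2] : Fin 2 → ℕ) 3 (X 0 + X 1 : MvPolynomial (Fin 2) k) = X 0 := by
  classical
  have hx : IsWeightedHomogeneous (![3, 2] : Fin 2 → ℕ) (X 0 : MvPolynomial (Fin 2) k) 3 :=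
    isWeightedHomogeneous_X k ![3, 2] 0
  have hy : (X 1 : MvPolynomial (Fin 2) k) ∈ weightedHomogeneousSubmodule k (![3, 2] : Fin 2 → ℕ) 2 :=
    (mem_weightedHomogeneousSubmodule k ![3, 2] 2 (X 1)).mpr (isWeightedHomogeneous_X k ![3, 2] 1)
  rw [map_add, weightedHomogeneousComponent_eq_self hx, weightedHomogeneousComponent_of_mem hy]
  simp

/-- **The filtration of the move `(x + y, y; 3, 2)` is not homogeneous** for the grading `wt x = 3, wt y = 2`:
`I₃` is not closed under taking weight-`3` components (witness `x + y ↦ x`). [folklore] -/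
theorem pieceThree_not_closed_under_component [Nontrivial k] :
    ¬ ∀ q ∈ weightedMonomialIdeal (![X 0 + X 1, X 1] : Fin 2 → MvPolynomial (Fin 2) k) ![3, 2] 3,
        weightedHomogeneousComponent (![3, 2] : Fin 2 → ℕ) 3 q ∈
          weightedMonomialIdeal (![X 0 + X 1, X 1] : Fin 2 → MvPolynomial (Fin 2) k) ![3, 2] 3 := by
  intro h
  have := h _ (add_mem_pieceThree k)
  rw [weightedHomogeneousComponent_three_X_add_X] at this
  exact X_zero_not_mem_pieceThree k this

end Summit.ResolutionOfSingularities.ResolutionOfSingularities.Theorems.WeightedConstruction.Negative.CuspInhomogeneousMove
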